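import Mathlib
import Literature.NumberTheory.Automorphic.CertifiedMaassHeckeTraceCensus
import Literature.NumberTheory.Sieve.LiouvillePolynomialValuesMajorArcMR

/-!
# Conjugation transport of certified deficit censuses (stub `stub_conjTransport`)

Crux `Summit.Langlands.Langlands.Theses.QuarterDeficit1951.CensusDeficit1951`
(stmt-Langlands-17933), line `conjugate-pair-census`, stub `stub_conjTransport`:
a certified Maass–Hecke trace census transcript with the deficit verdict for `(N, χ)` yields one
for `(N, χ⁻¹)` with the same window, tolerance and fingerprint primes.

The transported transcript is `c` with every complex box conjugated (`im ↦ [-hi, -lo]` in the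
`traces` and `chiBoxes` slots).  Two things are checked:

* **format invariance** (pure `ℚ` bookkeeping): the conjugated transcript has the same `m1hi`,
  `m1lo`, `upperCount`, `tailHi`, `hStar`, `wellFormed`, conjugated `muBox`/`fpBox` (the Moore
  product, widening and division by a positive real interval commute with `im ↦ -im` up to
  `min`/`max` bookkeeping) and the same `violates` verdicts (`distSqLower` is symmetric), hence the
  same `certifiesDeficit` verdict;
* **semantics**: complex conjugation `u ↦ conj ∘ u` carries weight-`0` Maass cusp forms on
  `(Γ₀(N), χ)` to those on `(Γ₀(N), χ⁻¹)` (same Laplace eigenvalue; `χ⁻¹ = conj ∘ χ`, the tree's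
  `Teravainen2024.inv_apply_eq_conj_apply`), commutes with the Hecke operators up to `χ ↦ χ⁻¹`,
  preserves linear independence and completeness, and conjugates the weighted Hecke traces, so the
  conjugated boxes enclose the joint spectral data of `(Γ₀(N), χ⁻¹)`.
-/

set_option linter.dupNamespace false

namespace Summit.Langlands.Langlands.Theorems.CensusDeficit1951

open Literature.NumberTheory.Automorphic
open Literature.NumberTheory.Sieve.Teravainen2024 (inv_apply_eq_conj_apply)
open scoped ComplexConjugate UpperHalfPlane

/-! ## 1. Interval and box bookkeeping under `im ↦ -im`

The negated interval of `I` is `[-I.hi, -I.lo]`; the conjugate box of `B` is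
`⟨B.re, [-B.im.hi, -B.im.lo]⟩`. -/

/-- Moore product of two negated intervals. [folklore] -/
theorem neg_mul_neg_ivl (I J : QIvl) : (⟨-I.hi, -I.lo⟩ : QIvl).mul ⟨-J.hi, -J.lo⟩ = I.mul J := by
  obtain ⟨a, b⟩ := I
  obtain ⟨c, d⟩ := J
  simp only [QIvl.mul, neg_mul_neg, min_comm, min_left_comm, max_comm, max_left_comm]

/-- Moore product with a negated right factor. [folklore] -/
theorem mul_neg_ivl (I J : QIvl) : I.mul ⟨-J.hi, -J.lo⟩ = ⟨-(I.mul J).hi, -(I.mul J).lo⟩ := by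
  obtain ⟨a, b⟩ := I
  obtain ⟨c, d⟩ := J
  simp only [QIvl.mul, mul_neg, min_neg_neg, max_neg_neg, min_comm, min_left_comm, max_comm,
    max_left_comm]

/-- Moore product with a negated left factor. [folklore] -/
theorem neg_mul_ivl (I J : QIvl) :
    (⟨-I.hi, -I.lo⟩ : QIvl).mul J = ⟨-(I.mul J).hi, -(I.mul J).lo⟩ := by
  obtain ⟨a, b⟩ := I
  obtain ⟨c, d⟩ := J
  simp only [QIvl.mul, neg_mul, min_neg_neg, max_neg_neg, min_comm, min_left_comm, max_comm,
    max_left_comm]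

/-- Sum of negated intervals. [folklore] -/
theorem neg_add_neg_ivl (I J : QIvl) :
    (⟨-I.hi, -I.lo⟩ : QIvl).add ⟨-J.hi, -J.lo⟩ = ⟨-(I.add J).hi, -(I.add J).lo⟩ := by
  simp only [QIvl.add, QIvl.mk.injEq]
  constructor <;> ring

/-- Widening commutes with negation. [folklore] -/
theorem neg_widen_ivl (I : QIvl) (e : ℚ) :
    (⟨-I.hi, -I.lo⟩ : QIvl).widen e = ⟨-(I.widen e).hi, -(I.widen e).lo⟩ := by
  simp only [QIvl.widen, QIvl.mk.injEq]
  constructor <;> ring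

/-- Division by a positive interval commutes with negation. [folklore] -/
theorem neg_divPos_ivl (I D : QIvl) :
    (⟨-I.hi, -I.lo⟩ : QIvl).divPos D = ⟨-(I.divPos D).hi, -(I.divPos D).lo⟩ := by
  simp only [QIvl.divPos, neg_div, min_neg_neg, max_neg_neg]

/-- Widening commutes with conjugation of boxes. [folklore] -/
theorem conj_widen_box (B : QCBox) (e : ℚ) :
    (⟨B.re, ⟨-B.im.hi, -B.im.lo⟩⟩ : QCBox).widen e =
      ⟨(B.widen e).re, ⟨-(B.widen e).im.hi, -(B.widen e).im.lo⟩⟩ := by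
  simp only [QCBox.widen, neg_widen_ivl]

/-- Division by a positive real interval commutes with conjugation of boxes. [folklore] -/
theorem conj_divPos_box (B : QCBox) (D : QIvl) :
    (⟨B.re, ⟨-B.im.hi, -B.im.lo⟩⟩ : QCBox).divPos D =
      ⟨(B.divPos D).re, ⟨-(B.divPos D).im.hi, -(B.divPos D).im.lo⟩⟩ := by
  simp only [QCBox.divPos, neg_divPos_ivl]

/-- The box product commutes with conjugation. [folklore] -/
theorem conj_mul_conj_box (A B : QCBox) :
    (⟨A.re, ⟨-A.im.hi, -A.im.lo⟩⟩ : QCBox).mul ⟨B.re, ⟨-B.im.hi, -B.im.lo⟩⟩ =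
      ⟨(A.mul B).re, ⟨-(A.mul B).im.hi, -(A.mul B).im.lo⟩⟩ := by
  simp only [QCBox.mul, neg_mul_neg_ivl]
  simp only [mul_neg_ivl, neg_mul_ivl, neg_add_neg_ivl]

/-- The box square commutes with conjugation. [folklore] -/
theorem conj_sq_box (A : QCBox) :
    (⟨A.re, ⟨-A.im.hi, -A.im.lo⟩⟩ : QCBox).sq = ⟨A.sq.re, ⟨-A.sq.im.hi, -A.sq.im.lo⟩⟩ := by
  simp only [QCBox.sq, conj_mul_conj_box]

/-- `distSqLower` is invariant under conjugation of the box. [folklore] -/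
theorem distSqLower_conj_box (B : QCBox) (I : QIvl) :
    (⟨B.re, ⟨-B.im.hi, -B.im.lo⟩⟩ : QCBox).distSqLower I = B.distSqLower I := by
  simp only [QCBox.distSqLower, neg_neg, max_comm]

/-- Membership is transported by conjugation. [folklore] -/
theorem mem_conj_box {B : QCBox} {z : ℂ} (h : B.mem z) :
    (⟨B.re, ⟨-B.im.hi, -B.im.lo⟩⟩ : QCBox).mem (conj z) := by
  obtain ⟨hre, h1, h2⟩ := h
  refine ⟨?_, ?_, ?_⟩
  · show B.re.mem (conj z).re
    rw [Complex.conj_re]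
    exact hre
  · show ((-B.im.hi : ℚ) : ℝ) ≤ (conj z).im
    rw [Complex.conj_im]
    push_cast
    linarith
  · show (conj z).im ≤ ((-B.im.lo : ℚ) : ℝ)
    rw [Complex.conj_im]
    push_cast
    linarith

/-- `lookup` in an association list with conjugated boxes. [folklore] -/
theorem lookup_map_conj_box (l : List (ℕ × QCBox)) (n : ℕ) :
    (l.map (fun q => (q.1, (⟨q.2.re, ⟨-q.2.im.hi, -q.2.im.lo⟩⟩ : QCBox)))).lookup n =
      (l.lookup n).map (fun B => (⟨B.re, ⟨-B.im.hi, -B.im.lo⟩⟩ : QCBox)) := by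
  induction l with
  | nil => rfl
  | cons q l ih =>
    obtain ⟨k, B⟩ := q
    simp only [List.map_cons, List.lookup_cons, ih]
    cases (n == k) <;> rfl

/-- Presence of entries is unchanged by conjugating the boxes. [folklore] -/
theorem isSome_lookup_map_conj_box (l : List (ℕ × QCBox)) (n : ℕ) :
    ((l.map (fun q => (q.1, (⟨q.2.re, ⟨-q.2.im.hi, -q.2.im.lo⟩⟩ : QCBox)))).lookup n).isSome =
      (l.lookup n).isSome := by
  rw [lookup_map_conj_box, Option.isSome_map]

/-! ## 2. Semantics: conjugation `χ ↦ χ⁻¹`, `u ↦ conj ∘ u` -/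

/-- The hyperbolic Laplacian commutes with complex conjugation. [folklore] -/
theorem hypLaplacian_conj (u : ℍ → ℂ) (z : ℍ) :
    hypLaplacian (fun w => conj (u w)) z = conj (hypLaplacian u z) := by
  have key := congrFun (InnerProductSpace.laplacian_CLE_comp_left (l := Complex.conjCLE)
    (f := (u ∘ UpperHalfPlane.ofComplex : ℂ → ℂ))) (z : ℂ)
  simp only [hypLaplacian, map_mul, map_pow, Complex.conj_ofReal]
  congr 1

/-- **Conjugation of Maass cusp forms**: `u ↦ conj ∘ u` carries weight-`0` Maass cusp forms on
`(Γ₀(N), χ)` to those on `(Γ₀(N), χ⁻¹)` with the same eigenvalue. [folklore] -/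
theorem isMaassCuspFormOn_conj {N : ℕ} {χ : DirichletCharacter ℂ N} {u : ℍ → ℂ} {lam : ℝ}
    (h : IsMaassCuspFormOn N χ u lam) : IsMaassCuspFormOn N χ⁻¹ (fun z => conj (u z)) lam where
  isC2 := by
    have h2 := h.isC2
    unfold IsC2 at h2 ⊢
    exact Complex.conjCLE.contDiff.comp_contDiffOn h2
  eigen z := by
    have e := congrArg conj (h.eigen z)
    rw [map_add, map_mul, Complex.conj_ofReal, map_zero, ← hypLaplacian_conj] at e
    exact e
  slash γ hγ z := by
    show conj (u (γ • z)) = χ⁻¹ ((γ 1 1 : ℤ) : ZMod N) * conj (u z)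
    rw [h.slash γ hγ z, map_mul, inv_apply_eq_conj_apply]
  cuspidal g y hy := by
    show ∫ x in (0 : ℝ)..(N : ℝ),
        conj (u (g • UpperHalfPlane.ofComplex ((x : ℂ) + y * Complex.I))) = 0
    rw [intervalIntegral.intervalIntegral_conj, h.cuspidal g y hy, map_zero]
  bounded := by
    obtain ⟨C, hC⟩ := h.bounded
    exact ⟨C, fun z => by rw [Complex.norm_conj]; exact hC z⟩

/-- The Hecke operators commute with conjugation up to `χ ↦ χ⁻¹`. [folklore] -/
theorem maassHeckeOp_conj {N : ℕ} (χ : DirichletCharacter ℂ N) (n : ℕ) (u : ℍ → ℂ) :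
    maassHeckeOp N χ⁻¹ n (fun z => conj (u z)) = fun z => conj (maassHeckeOp N χ n u z) := by
  funext z
  simp only [maassHeckeOp, map_mul, map_sum, map_inv₀, Complex.conj_ofReal,
    inv_apply_eq_conj_apply]

/-- **Conjugation of joint spectral data**: the lines `(λ_j, conj ∘ λ_j(·))` are joint spectral
data for `χ⁻¹` (eigenbasis `conj ∘ u_j`). [folklore] -/
theorem isJointSpectralData_conj {N : ℕ} {χ : DirichletCharacter ℂ N} {P : Finset ℕ} {J : Type*}
    {d : J → MaassHeckeTraceCensus.SpectralLine}
    (hJ : MaassHeckeTraceCensus.IsJointSpectralData N χ P d) :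
    MaassHeckeTraceCensus.IsJointSpectralData N χ⁻¹ P
      (fun j => (⟨(d j).lam, fun n => conj ((d j).hecke n)⟩ :
        MaassHeckeTraceCensus.SpectralLine)) where
  lam_pos j := hJ.lam_pos j
  hecke_one j := by
    show conj ((d j).hecke 1) = 1
    rw [hJ.hecke_one, map_one]
  norm_hecke_le j n hn := by
    show ‖conj ((d j).hecke n)‖ * Real.sqrt n ≤ _
    rw [Complex.norm_conj]
    exact hJ.norm_hecke_le j n hn
  exists_eigenbasis := by
    obtain ⟨u, hform, hHecke, hli, hspan⟩ := hJ.exists_eigenbasis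
    refine ⟨fun j z => conj (u j z), fun j => isMaassCuspFormOn_conj (hform j),
      fun j n hn => ?_, ?_, fun v lam hv => ?_⟩
    · show maassHeckeOp N χ⁻¹ n (fun z => conj (u j z)) =
        conj ((d j).hecke n) • fun z => conj (u j z)
      rw [maassHeckeOp_conj, hHecke j n hn]
      funext z
      simp only [Pi.smul_apply, smul_eq_mul, map_mul]
    · rw [linearIndependent_iff'] at hli ⊢
      intro s g hg i hi
      have key : ∑ i ∈ s, (conj (g i)) • u i = 0 := by
        funext z
        have hz := congrArg conj (congrFun hg z)
        simp only [Finset.sum_apply, Pi.smul_apply, smul_eq_mul, Pi.zero_apply, map_sum, map_mul,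
          Complex.conj_conj, map_zero] at hz
        simpa only [Finset.sum_apply, Pi.smul_apply, smul_eq_mul, Pi.zero_apply] using hz
      have h0 := hli s _ key i hi
      simpa using h0
    · show v ∈ Submodule.span ℂ ((fun j z => conj (u j z)) '' {j | (d j).lam = lam})
      have hv' : IsMaassCuspFormOn N χ (fun z => conj (v z)) lam := by
        have := isMaassCuspFormOn_conj hv
        rwa [inv_inv] at this
      have key : ∀ (S : Set J) (w : ℍ → ℂ), w ∈ Submodule.span ℂ (u '' S) →
          (fun z => conj (w z)) ∈ Submodule.span ℂ ((fun j z => conj (u j z)) '' S) := by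
        intro S w hw
        induction hw using Submodule.span_induction with
        | mem x hx =>
          obtain ⟨j, hj, rfl⟩ := hx
          exact Submodule.subset_span ⟨j, hj, rfl⟩
        | zero =>
          have e : (fun z => conj ((0 : ℍ → ℂ) z)) = 0 := funext fun z => by simp
          rw [e]
          exact Submodule.zero_mem _
        | add x y _ _ hx hy =>
          have e : (fun z => conj ((x + y) z)) = (fun z => conj (x z)) + fun z => conj (y z) :=
            funext fun z => by simp
          rw [e]
          exact Submodule.add_mem _ hx hy
        | smul a x _ hx =>
          have e : (fun z => conj ((a • x) z)) = conj a • fun z => conj (x z) :=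
            funext fun z => by simp
          rw [e]
          exact Submodule.smul_mem _ _ hx
      have := key {j | (d j).lam = lam} _ (hspan _ lam hv')
      simpa using this

/-! ## 3. The stub -/

/-- **Stub `stub_conjTransport` (conjugation transport of certified deficit censuses).** For every
level `N`, character `χ` and transcript `c`: if `c` is a certified Maass–Hecke trace census for
`(N, χ)` with the deficit verdict, then some transcript `c'` with the same window, tolerance and
fingerprint primes is a certified census for `(N, χ⁻¹)` with the deficit verdict (`c'` = `c` with
all boxes conjugated). [folklore] -/
theorem stub_conjTransport :
    ∀ (N : ℕ) (χ : DirichletCharacter ℂ N) (c : MaassHeckeTraceCensus),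
      CertifiedMaassHeckeTraceCensus N χ c → c.certifiesDeficit = true →
      ∃ c' : MaassHeckeTraceCensus, c'.window = c.window ∧ c'.fpTol = c.fpTol ∧
        c'.fpPrimes = c.fpPrimes ∧ CertifiedMaassHeckeTraceCensus N χ⁻¹ c' ∧
        c'.certifiesDeficit = true := by
  intro N χ c hc hv
  unfold CertifiedMaassHeckeTraceCensus at hc
  obtain ⟨hlevel, hw, J, d, hJ, hE⟩ := hc
  -- the transported transcript: every complex box conjugated
  obtain ⟨c', hc'⟩ : ∃ c' : MaassHeckeTraceCensus, c' =
      ⟨c.level, c.window, c.fpPrimes, c.fpTol, c.maj, c.hlo, c.hhi,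
        c.traces.map (fun q => (q.1, (⟨q.2.re, ⟨-q.2.im.hi, -q.2.im.lo⟩⟩ : QCBox))), c.heckeC,
        c.chiBoxes.map (fun q => (q.1, (⟨q.2.re, ⟨-q.2.im.hi, -q.2.im.lo⟩⟩ : QCBox))), c.tail⟩ :=
    ⟨_, rfl⟩
  /- (1) format invariance -/
  have htr : ∀ n, c'.trace n = ⟨(c.trace n).re, ⟨-(c.trace n).im.hi, -(c.trace n).im.lo⟩⟩ := by
    intro n
    subst hc'
    simp only [MaassHeckeTraceCensus.trace, lookup_map_conj_box]
    cases c.traces.lookup n with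
    | none => simp [QCBox.zero]
    | some B => rfl
  have hchi : ∀ p, c'.chiBox p =
      ⟨(c.chiBox p).re, ⟨-(c.chiBox p).im.hi, -(c.chiBox p).im.lo⟩⟩ := by
    intro p
    subst hc'
    simp only [MaassHeckeTraceCensus.chiBox, lookup_map_conj_box]
    cases c.chiBoxes.lookup p with
    | none => simp [QCBox.zero]
    | some B => rfl
  have hC : ∀ p, c'.C p = c.C p := fun p => by subst hc'; rfl
  have hm1hi : c'.m1hi = c.m1hi := by simp only [MaassHeckeTraceCensus.m1hi, htr]
  have hm1lo : c'.m1lo = c.m1lo := by simp only [MaassHeckeTraceCensus.m1lo, htr]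
  have hupper : c'.upperCount = c.upperCount := by
    subst hc'
    simp only [MaassHeckeTraceCensus.upperCount, hm1hi]
  have htailHi : c'.tailHi = c.tailHi := by
    subst hc'
    simp only [MaassHeckeTraceCensus.tailHi, hm1hi]
  have hhStar : c'.hStar = c.hStar := by
    subst hc'
    simp only [MaassHeckeTraceCensus.hStar, hm1lo, hm1hi, htailHi]
  have hmu : ∀ p, c'.muBox p = ⟨(c.muBox p).re, ⟨-(c.muBox p).im.hi, -(c.muBox p).im.lo⟩⟩ := by
    intro p
    simp only [MaassHeckeTraceCensus.muBox, htr, hC, htailHi, hhStar, conj_widen_box,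
      conj_divPos_box]
  have hfp : ∀ p, c'.fpBox p = ⟨(c.fpBox p).re, ⟨-(c.fpBox p).im.hi, -(c.fpBox p).im.lo⟩⟩ := by
    intro p
    simp only [MaassHeckeTraceCensus.fpBox, hmu, hchi, conj_sq_box, conj_mul_conj_box]
  have hviol : ∀ p, c'.violates p = c.violates p := by
    intro p
    subst hc'
    simp only [MaassHeckeTraceCensus.violates, hfp, distSqLower_conj_box]
  have hwf : c'.wellFormed = true := by
    subst hc'
    unfold MaassHeckeTraceCensus.wellFormed at hw ⊢
    rw [Bool.and_eq_true] at hw ⊢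
    obtain ⟨h1, h2⟩ := hw
    refine ⟨decide_eq_true ?_, h2⟩
    simpa only [isSome_lookup_map_conj_box, hC] using of_decide_eq_true h1
  have hcd : c'.certifiesDeficit = true := by
    subst hc'
    unfold MaassHeckeTraceCensus.certifiesDeficit at hv ⊢
    simp only [Bool.and_eq_true, Bool.or_eq_true, beq_iff_eq, List.any_eq_true] at hv ⊢
    obtain ⟨-, hU⟩ := hv
    refine ⟨hwf, ?_⟩
    rw [hupper]
    rcases hU with hU | ⟨hU, p, hp, hvp⟩
    · exact Or.inl hU
    · exact Or.inr ⟨hU, p, hp, by rw [hviol]; exact hvp⟩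
  /- (2) semantics -/
  refine ⟨c', ?_, ?_, ?_, ?_, hcd⟩
  · subst hc'; rfl
  · subst hc'; rfl
  · subst hc'; rfl
  subst hc'
  refine ⟨hlevel, hwf, J, _, isJointSpectralData_conj hJ, ?_⟩
  exact
    { trace_mem := fun n hn => by
        obtain ⟨s, hs, hmem⟩ := hE.trace_mem n hn
        refine ⟨conj s, ?_, ?_⟩
        · have := Complex.hasSum_conj'.mpr hs
          simp only [map_mul, Complex.conj_ofReal] at this
          exact this
        · rw [htr]
          exact mem_conj_box hmem
      window_bounds := hE.window_bounds
      chi_mem := fun p hp => by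
        rw [hchi, inv_apply_eq_conj_apply]
        exact mem_conj_box (hE.chi_mem p hp)
      tail_spec := hE.tail_spec }

end Summit.Langlands.Langlands.Theorems.CensusDeficit1951
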